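import Literature.MathematicalPhysics.QuantumFieldTheory.Balaban1983to89.B9Thm313WholeDirInputB
import Literature.MathematicalPhysics.QuantumFieldTheory.Balaban1983to89.B9Thm313WholeDirInputZ

/-!
# `Balaban1983to89.B9Thm313WholeDirInputBZ` — [B9] Theorem 3.13 (p. 426), DIRECTION-INDEXED INPUT-HÖLDER lines with ε-INDEXED constants, COARSE-FIELD
# LETTERS RE-CLASSED (Z-twin of `B9Thm313WholeDirInputB`; R1-cls of the cell's located «C-LETTER-FLAT-AT-ONE»)

T. Bałaban, *Propagators for lattice gauge theories in a background field*, Commun. Math. Phys. **99** (1985) 389–434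
[`Balaban1985BackgroundPropagators`, "B9"]; [4] = T. Bałaban, *Propagators and renormalization transformations for lattice
gauge theories. II*, Commun. Math. Phys. **96** (1984) 223–250 [`Balaban1984PropagatorsII`].  statement-level skeleton of published
theorems with citation tags; proofs where landed; nothing here is a claim about the Yang–Mills mass gap.

THE POINT.  The four (3.44) ∕ (3.45) theorems of `B9Thm313WholeDirInputB` (schemas `StepDirB`, `Letters313IMB`, the consumed ones of the knit's PairMB
leaf) with the coarse-field letters in the weighted classes `Z_{wZ}`, `Z_{len·wZ}` of `B9Thm313WholeZ` (`hL : Letters313Z`, `hLDM : Letters313DMZ`):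
★ `GG_input44m_of_lettersBZ`, ★ `GG_input45m_of_lettersBZ`, ★ `GG_input44Family_of_lettersBZ`, ★ `GG_input45Family_of_lettersBZ` — SAME conclusions and
constants; proofs verbatim but for `hasMaj_right_of_step_weight` and `B9Thm313WholeInputZ.hasMaj_transfer_weight`, composed by
`B9Thm313WholeDirInputZ.GG_input_of_piecesFZ`.  `wZ ≡ 1` recovers the flat statements.

HONEST SCOPE.  Nothing of print is asserted: the letters are HYPOTHESES of printed ∕ md shape; kernel-checked bookkeeping.  NOT a node discharge, NOT
summit progress; one finite lattice at a time; nothing continuum, nothing about the mass gap.  Cell `pub-ymgap` (HUMAN RULING D-0062), Track A node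
N06 [B9], N06-ASSIGNMENT v1 row 21 (bundle F7), seat `pub-ymgap-dag-n06-l` (g14), 2026-08-27.  NEW file; nothing landed is modified.
-/

namespace Literature.MathematicalPhysics.QuantumFieldTheory.Balaban1983to89.B9Thm313WholeDirInputBZ

open Literature.MathematicalPhysics.QuantumFieldTheory.Balaban1983to89
open Finset B6RandomWalk B6RandomWalkHom B9Thm34Ext B9Thm37GlueCor36 B11SectG B9SectDSup
open B9Thm37AllNorms B9Thm37AllNormsInstances B9Thm312Whole B9Thm312WholeLeaf B9Thm312WholeLeft B9Thm313Whole B9Thm313WholeLeft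
open B9RWSums343Holder B9Ineq347 B9Thm312WholeClasses B9Thm312WholeHolder B9Thm312WholeHHolder B9Thm313WholeHolder B9Thm313WholeInput
open B9RWSums346SecondDiff B9RWSums344InputFam B9Thm312WholeDir B9Thm313WholeDir B9Thm313WholeDirInput B9Thm312WholeDirB
open B9Thm313WholeDirInputB B9Thm313WholeZ B9Thm313WholeLeftZ B9Thm313WholeHolderZ B9Thm313WholeInputZ B9Thm313WholeDirZ
open B9Thm313WholeDirInputZ

noncomputable section

section OneMember

variable {g : B9.Geometry} {B : B9.Backgrounds} {X Y Z W PX PY P : Type}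
variable [Fintype X] [Fintype Y] [Fintype Z] [Fintype W] [Fintype PX] [Fintype PY] [Fintype P] [Fintype g.Site]
variable {R₀ : ℝ} {H₀ : Prop}

omit [Fintype X] [Fintype Y] [Fintype Z] [Fintype W] [Fintype PX] [Fintype PY] [Fintype P] in
/-- Raising the constant of an exponential majorant. [folklore] -/
private theorem maj_mono_const_z {F₁ F₂ : Type} [AddCommGroup F₁] [Module ℝ F₁] [AddCommGroup F₂] [Module ℝ F₂]
    {b₁ : BlockNorm (toB6 g R₀ H₀) F₁} {b₂ : BlockNorm (toB6 g R₀ H₀) F₂} {T : F₁ →ₗ[ℝ] F₂} {C C' δK : ℝ} (hCC' : C ≤ C')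
    (h : HasMaj b₁ b₂ T (fun a b => C * Real.exp (-(δK * g.dist a b)))) :
    HasMaj b₁ b₂ T (fun a b => C' * Real.exp (-(δK * g.dist a b))) :=
  h.mono fun _ _ => mul_le_mul_of_nonneg_right hCC' (Real.exp_nonneg _)

/-! ## §1 (3.44), (3.45) for 𝔊 per pair and on the family, indexed constants, coarse letters re-classed -/

omit [Fintype P] in
/-- ★ **(3.44) FOR 𝔊 = 𝔓G₁ PER DIRECTION PAIR, PRINTED SHAPE, ε-INDEXED STEP ∕ LETTER CONSTANTS** (Z-twin of `B9Thm313WholeDirInputB.GG_input44m_of_lettersB`: letters `Letters313Z ∕ Letters313DMZ`, one free weight `wZ`) — ∇_{U,ν}𝔊∇\*_{U,μ} read from the input Hölder class `bHX ε` of X-functions into the block sup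
norm of X: |(∇_{U,ν}𝔊∇\*_{U,μ}λ)(x)| ≦ K·e^{−ρ₄d(y,y′)}(‖λ‖_ε + |λ|) for x ∈ Δ(y), supp λ ⊂ Δ̃(y′), K = `constI44 θ θ_D θ_H θ_v B₀ B₃ B_i(ε) B_d(ε) B_r Λ κ_W c`
(the sibling's constant).  Route: (3.153) with E = ∇_{U,ν}, F = ∇\*_{U,μ} (`GG_input_of_piecesF`); ∇_νG₁∇\*_μ and ∇_νG₁Dv by r1's right form (`input44_of_step` ∕
`input44_of_stepV` from Theorem 3.3's (3.44) per pair `Thm33G0Dir.h44m` ∕ the letter `Letters313IM.dgDvd`, the steps `StepDir.tDd1` ∕ `Letters313IM.tDv`,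
the per-direction left entry ∇_{U,ν}G₁ of `B9Thm312WholeLeft.entry1_of_stepD` (`Thm33G0Dir.e1d`, `StepDir.sDd1`) transferred by (2.60)); ∇_νG₁Q\* by
`hasMaj_left_right` (letters `Letters313DMZ.dgQsd`, `Letters313Z.gQs2`, class `Z_{wZ}`) transferred by (2.60) (`hasMaj_transfer_weight`) to
Z_{len·wZ} → 𝔠^{(0)}.  Provisos: ρ₄ + 3σ ≦ (1 − α)r, r ≦ δ₀, r ≦ δ₃,
r + σ ≦ δ_K, θc < 1 — the per-pair twin of `B9Thm313WholeInput.GG_input44_of_letters`.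
[cite: Balaban1985BackgroundPropagators, Thm 3.13 p.426 + (3.153) p.426 + (3.44) p.398 + (3.39) p.397 + Thm 3.12 p.423 + p.398 (remark after (3.47)); Balaban1984PropagatorsII, Lemma 2.1 (2.60)–(2.61) p.234] -/
theorem GG_input44m_of_lettersBZ (hG : GeoOK g) (𝔭 : HolderProbes g B X Y PX PY) {𝔬 : Ops g B X Y Z W} {U : B.Cfg}
    {Dd Dds : B.Cfg → P → Module.End ℝ (X → ℝ)}
    {bHX : ℝ → BlockNorm (toB6 g R₀ H₀) (X → ℝ)} {bHW : ℝ → BlockNorm (toB6 g R₀ H₀) (W → ℝ)} {bH : BlockNorm (toB6 g R₀ H₀) (W → ℝ)}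
    {Bh Bi Bq Bd θH θI θv Br : ℝ → ℝ} {Bi2 Bd2 : ℝ → ℝ → ℝ} {θ θD B₀ B₃ δ₀ δ₃ δK r ρ₄ α Λ σ c ε : ℝ}
    (hrow : RowSum (toB6 g R₀ H₀) σ c)
    (hc : 0 ≤ c) (hθ : 0 ≤ θ) (hθD : 0 ≤ θD) (hθH : 0 ≤ θI ε) (hθv : 0 ≤ θv ε) (hB₀ : 0 ≤ B₀) (hB₃ : 0 ≤ B₃) (hBi : 0 ≤ Bi ε)
    (hBd : 0 ≤ Bd ε) (hBr : 0 ≤ Br ε) (hΛ : 0 ≤ Λ) (hα : 0 ≤ α) (hσ : 0 ≤ σ) (hε0 : 0 < ε) (hε1 : ε ≤ 1) (hρ₄ : 0 ≤ ρ₄)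
    (hρ₄r : ρ₄ + 3 * σ ≤ (1 - α) * r) (hr : 0 ≤ r) (hr0 : r ≤ δ₀) (hr₃ : r ≤ δ₃) (hrK : r + σ ≤ δK) (hq : θ * c < 1)
    (hST : ScaleTransfer g r α Λ (fun y => g.len y ^ (1 : ℝ)))
    (hK1 : HasMaj (cNorm R₀ H₀ 𝔬.blk hG.lenle 1) (cNorm R₀ H₀ 𝔬.blk hG.lenle 1) (𝔬.G0 U ∘ₗ (𝔬.Tpi U + 𝔬.T2 U))
      (fun a b => θ * Real.exp (-(δK * g.dist a b))))
    (hK2 : HasMaj (cNorm R₀ H₀ 𝔬.blk hG.lenle 2) (cNorm R₀ H₀ 𝔬.blk hG.lenle 2) (𝔬.G0 U ∘ₗ (𝔬.Tpi U + 𝔬.T2 U))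
      (fun a b => θ * Real.exp (-(δK * g.dist a b))))
    (he0 : HasMajorant (g := toB6 g R₀ H₀) 𝔬.blk (𝔬.G0 U) (fun a b => B₀ * g.len a ^ 2 * Real.exp (-(δ₀ * g.dist a b))))
    (hH0 : Thm33G0Dir 𝔬 𝔭 Dd Dds R₀ H₀ bHX B₀ Bh Bi Bi2 δ₀ U) (hHR : Thm33G0DirR 𝔬 Dds R₀ H₀ B₀ δ₀ U)
    (hSD : StepDirB 𝔬 𝔭 Dd Dds R₀ H₀ bHX hG.lenle θD θH θI δK U)
    {wZ : g.Site → ℝ} {hwZ : ∀ y, 0 < wZ y}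
    (hL : Letters313Z 𝔬 R₀ H₀ hG wZ hwZ B₃ δ₃ U) (hLDM : Letters313DMZ 𝔬 𝔭 Dd R₀ H₀ hG wZ hwZ B₃ Bq δ₃ bH U)
    (hLIM : Letters313IMB 𝔬 𝔭 Dd Dds R₀ H₀ hG.lenle bHX bHW Br θv Bd Bd2 δ₃ δK U) (hI : Identities 𝔬 U) (ν μ : P) :
    HasMaj (bHX ε) (BlockNorm.ofBlocks (toB6 g R₀ H₀) 𝔬.blk) (Dd U ν ∘ₗ (𝔬.GG U ∘ₗ Dds U μ))
      (fun (a b : g.Site) => constI44 θ θD (θI ε) (θv ε) B₀ B₃ (Bi ε) (Bd ε) (Br ε) Λ (bHW ε).κ c * Real.exp (-(ρ₄ * g.dist a b))) := by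
  -- adapted from `B9Thm313WholeInput.GG_input44_of_letters` (direction letters, X-inputs)
  have hfix1 := fix_of_inverses hI.invG0' hI.invG1
  have hfixR := fix_right_of_inverses hI.invG0' hI.invG1
  have hq1 : 0 ≤ (1 - θ * c)⁻¹ := inv_nonneg.mpr (by linarith)
  have hA₁ : 0 ≤ B₀ * (1 - θ * c)⁻¹ := mul_nonneg hB₀ hq1
  have hA₃ : 0 ≤ B₃ * (1 - θ * c)⁻¹ := mul_nonneg hB₃ hq1
  have hCL : 0 ≤ B₀ + θD * (B₀ * (1 - θ * c)⁻¹) * c := add_nonneg hB₀ (mul_nonneg (mul_nonneg hθD hA₁) hc)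
  have hKQ' : 0 ≤ B₃ + θD * (B₃ * (1 - θ * c)⁻¹) * c := add_nonneg hB₃ (mul_nonneg (mul_nonneg hθD hA₃) hc)
  -- rates
  have h1α : (1 - α) * r ≤ r := by rw [sub_mul, one_mul]; exact sub_le_self _ (mul_nonneg hα hr)
  have hρ₂0 : 0 ≤ ρ₄ + 2 * σ := by linarith
  have hρ₂σ : ρ₄ + 2 * σ + σ ≤ (1 - α) * r := by linarith
  have hρ₂α : ρ₄ + 2 * σ ≤ (1 - α) * r := by linarith
  have hρ₂r : ρ₄ + 2 * σ ≤ r := by linarith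
  have hρ₂K : ρ₄ + 2 * σ ≤ δK := by linarith
  have hρ₂0' : ρ₄ + 2 * σ ≤ δ₀ := by linarith
  have hρ₂₃ : ρ₄ + 2 * σ ≤ δ₃ := by linarith
  have hρ₂₃σ : ρ₄ + 2 * σ + σ ≤ δ₃ := by linarith
  -- the per-direction left entry ∇_{U,ν}G₁ at the rate r
  have hm1 := entry1_of_stepD hG hrow hθ hθD hB₀ hr hr0 hrK hK2 (hSD.sDd1 ν) he0 (hH0.e1d ν) hfix1 hq
  -- ∇_νG₁∇*_μ from `bHX ε` and ∇_νG₁Dv from `bHW ε` by the right form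
  have hGop := input44_of_step hG hrow hθH hBi hCL hΛ hρ₂0 hρ₂σ hρ₂K hρ₂0' hST hm1 (hH0.h44m (ν, μ) ε hε0 hε1)
    (hSD.tDd1 μ ε hε0) hfixR
  have hGD := input44_of_stepV hG hrow hθv hBd hCL hΛ hρ₂0 hρ₂σ hρ₂K hρ₂₃ hST hm1 (hLIM.dgDvd ν ε hε0 hε1) (hLIM.tDv ε hε0)
    hfixR
  -- ∇_νG₁Q* : Z_{wZ} → 𝔠⁽¹⁾ by the left form, then (2.60) for the weighted source: Z_{len·wZ} → 𝔠^{(0)}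
  have hGQr := hasMaj_right_of_step_weight hG hwZ hrow hθ hB₃ hr hr₃ hrK hK2 hL.gQs2 hfix1 hq
  have hDQ := hasMaj_left_right hG hrow hθD hB₃ hA₃ hr hr₃ le_rfl hrK (hSD.sDd1 ν) (hLDM.dgQsd ν) hGQr hfix1
  have hDQR : HasMaj (weightNorm (BlockNorm.ofBlocks (toB6 g R₀ H₀) 𝔬.blkZ) wZ fun y => (hwZ y).le) (cNormR R₀ H₀ 𝔬.blk hG.lenle (-1))
      (Dd U ν ∘ₗ 𝔬.G1 U ∘ₗ 𝔬.Qstar U) (fun y y' => (B₃ + θD * (B₃ * (1 - θ * c)⁻¹) * c) * Real.exp (-(r * g.dist y y'))) := by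
    have h := hasMaj_toR_tgt hG hDQ
    simp only [Nat.cast_one] at h
    exact h
  have hDQT := hasMaj_transfer_weight hG (fun y => (hwZ y).le) hKQ' hST hDQR
  have e2 : (-1 : ℝ) + 1 = 0 := by ring
  rw [e2] at hDQT
  have hGQ : HasMaj (weightNorm (BlockNorm.ofBlocks (toB6 g R₀ H₀) 𝔬.blkZ) (fun y => g.len y * wZ y) fun y => (wZlen_pos hG hwZ y).le)
      (BlockNorm.ofBlocks (toB6 g R₀ H₀) 𝔬.blk) (Dd U ν ∘ₗ 𝔬.G1 U ∘ₗ 𝔬.Qstar U)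
      (fun a b => (B₃ + θD * (B₃ * (1 - θ * c)⁻¹) * c) * Λ * Real.exp (-((ρ₄ + 2 * σ) * g.dist a b))) :=
    hasMaj_of_out_zero (hDQT.of_rate_le hG.dnn (mul_nonneg hKQ' hΛ) hρ₂α)
  -- (3.153)
  have h := GG_input_of_piecesFZ hG hrow hc hθ hB₀ hB₃ hBr (add_nonneg hBi (mul_nonneg (mul_nonneg (mul_nonneg hCL hΛ) hθH) hc))
    (add_nonneg hBd (mul_nonneg (mul_nonneg (mul_nonneg hCL hΛ) hθv) hc)) (mul_nonneg hKQ' hΛ) hσ hρ₄ le_rfl hρ₂r hρ₂₃σ hr hr0 hrK hq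
    hK1 (hHR.e2d μ) hL hI (hLIM.domX ε hε0) (hLIM.locX ε hε0) (hLIM.rgdd μ ε hε0) hGop hGD hGQ
  refine h.mono fun a b => le_of_eq ?_
  simp only [constI44]

omit [Fintype P] in
/-- ★ **(3.45) FOR 𝔊 = 𝔓G₁ PER DIRECTION PAIR, PRINTED SHAPE, β∕ε-INDEXED CONSTANTS** (Z-twin of `…GG_input45m_of_lettersB` over `Letters313Z ∕ Letters313DMZ`; probe step at β and input step at β + ε read at θ_M = max(θ_H β, θ_I (β+ε))) — Φ^X_β∘∇_{U,ν}𝔊∇\*_{U,μ} read from the input Hölder class `bHX (β+ε)` into the probe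
blocks of X: ‖ζ∇_{U,ν}𝔊∇\*_{U,μ}λ‖_β-type bound K·(Lʲη)^{−β}·e^{−ρ₄d(y,y′)}(‖λ‖_{β+ε} + |λ|), K = `constI45 θ θ_H θ_v B₀ B₃ B_h B_i2 B_d2 B_q B_r Λ κ_W c`
(the sibling's constant).  Route: (3.153) with E = Φ^X_β∘∇_{U,ν} in the real class 𝔠_P^{(β)} (`GG_input_of_piecesF`); Φ^X_β∇_νG₁∇\*_μ and Φ^X_β∇_νG₁Dv
by the right form (`input45_of_step` from Theorem 3.3's (3.45) per pair `Thm33G0Dir.h45m` ∕ the letter `Letters313IM.pdgDvd`, the steps `StepDir.tDd1` ∕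
`Letters313IM.tDv`, the probe entry `B9Thm312WholeDir.probe43d_cNormR` from `Thm33G0Dir.h43d` ∕ `StepDir.pXd1`); Φ^X_β∇_νG₁Q\* by `hasMaj_left_rightR`
(letters `Letters313DM.pQd`, `gQs2`, the probe step `pXd1`) transferred by (2.60).  Provisos as for (3.44) — the per-pair twin of
`B9Thm313WholeInput.GG_input45_of_letters`.
[cite: Balaban1985BackgroundPropagators, Thm 3.13 p.426 + (3.153) p.426 + (3.45) p.398 + (3.39)–(3.40) p.397 + Thm 3.12 p.423 + p.398 (remark after (3.47)); Balaban1984PropagatorsII, Lemma 2.1 (2.60)–(2.61) p.234] -/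
theorem GG_input45m_of_lettersBZ (hG : GeoOK g) (𝔭 : HolderProbes g B X Y PX PY) {𝔬 : Ops g B X Y Z W} {U : B.Cfg}
    {Dd Dds : B.Cfg → P → Module.End ℝ (X → ℝ)}
    {bHX : ℝ → BlockNorm (toB6 g R₀ H₀) (X → ℝ)} {bHW : ℝ → BlockNorm (toB6 g R₀ H₀) (W → ℝ)} {bH : BlockNorm (toB6 g R₀ H₀) (W → ℝ)}
    {Bh Bi Bq Bd θH θI θv Br : ℝ → ℝ} {Bi2 Bd2 : ℝ → ℝ → ℝ} {θ θD B₀ B₃ β δ₀ δ₃ δK r ρ₄ α Λ σ c ε : ℝ}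
    (hrow : RowSum (toB6 g R₀ H₀) σ c)
    (hc : 0 ≤ c) (hθ : 0 ≤ θ) (hθH : 0 ≤ θH β) (hθv : 0 ≤ θv (β + ε)) (hB₀ : 0 ≤ B₀) (hB₃ : 0 ≤ B₃)
    (hBh : 0 ≤ Bh β) (hBi2 : 0 ≤ Bi2 ε β)
    (hBq : 0 ≤ Bq β) (hBd2 : 0 ≤ Bd2 ε β) (hBr : 0 ≤ Br (β + ε)) (hΛ : 0 ≤ Λ) (hα : 0 ≤ α) (hσ : 0 ≤ σ) (hε0 : 0 < ε) (hε1 : ε ≤ 1)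
    (hβ0 : 0 ≤ β) (hβ1 : β < 1) (hρ₄ : 0 ≤ ρ₄) (hρ₄r : ρ₄ + 3 * σ ≤ (1 - α) * r) (hr : 0 ≤ r) (hr0 : r ≤ δ₀) (hr₃ : r ≤ δ₃)
    (hrK : r + σ ≤ δK) (hq : θ * c < 1) (hST : ScaleTransfer g r α Λ (fun y => g.len y ^ (1 : ℝ)))
    (hK1 : HasMaj (cNorm R₀ H₀ 𝔬.blk hG.lenle 1) (cNorm R₀ H₀ 𝔬.blk hG.lenle 1) (𝔬.G0 U ∘ₗ (𝔬.Tpi U + 𝔬.T2 U))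
      (fun a b => θ * Real.exp (-(δK * g.dist a b))))
    (hK2 : HasMaj (cNorm R₀ H₀ 𝔬.blk hG.lenle 2) (cNorm R₀ H₀ 𝔬.blk hG.lenle 2) (𝔬.G0 U ∘ₗ (𝔬.Tpi U + 𝔬.T2 U))
      (fun a b => θ * Real.exp (-(δK * g.dist a b))))
    (he0 : HasMajorant (g := toB6 g R₀ H₀) 𝔬.blk (𝔬.G0 U) (fun a b => B₀ * g.len a ^ 2 * Real.exp (-(δ₀ * g.dist a b))))
    (hH0 : Thm33G0Dir 𝔬 𝔭 Dd Dds R₀ H₀ bHX B₀ Bh Bi Bi2 δ₀ U) (hHR : Thm33G0DirR 𝔬 Dds R₀ H₀ B₀ δ₀ U)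
    (hSD : StepDirB 𝔬 𝔭 Dd Dds R₀ H₀ bHX hG.lenle θD θH θI δK U)
    {wZ : g.Site → ℝ} {hwZ : ∀ y, 0 < wZ y}
    (hL : Letters313Z 𝔬 R₀ H₀ hG wZ hwZ B₃ δ₃ U) (hLDM : Letters313DMZ 𝔬 𝔭 Dd R₀ H₀ hG wZ hwZ B₃ Bq δ₃ bH U)
    (hLIM : Letters313IMB 𝔬 𝔭 Dd Dds R₀ H₀ hG.lenle bHX bHW Br θv Bd Bd2 δ₃ δK U) (hI : Identities 𝔬 U) (ν μ : P) :
    HasMaj (bHX (β + ε)) (BlockNorm.ofBlocks (toB6 g R₀ H₀) 𝔭.blkPX) ((𝔭.ΦX U β ∘ₗ Dd U ν) ∘ₗ (𝔬.GG U ∘ₗ Dds U μ))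
      (fun (a b : g.Site) => constI45 θ (max (θH β) (θI (β + ε))) (θv (β + ε)) B₀ B₃ (Bh β) (Bi2 ε β) (Bd2 ε β) (Bq β) (Br (β + ε)) Λ
        (bHW (β + ε)).κ c * g.len a ^ (-β) * Real.exp (-(ρ₄ * g.dist a b))) := by
  -- adapted from `B9Thm313WholeDirInput.GG_input45m_of_letters`: the probe step at β and the input step at β + ε are read at the common constant θ_M
  set θM : ℝ := max (θH β) (θI (β + ε)) with hθMdef
  have hθM : 0 ≤ θM := le_max_of_le_left hθH
  have htri : Triangle254 (toB6 g R₀ H₀) := fun a b c => hG.tri a b c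
  have hfix1 := fix_of_inverses hI.invG0' hI.invG1
  have hfixR := fix_right_of_inverses hI.invG0' hI.invG1
  have hq1 : 0 ≤ (1 - θ * c)⁻¹ := inv_nonneg.mpr (by linarith)
  have hA₁ : 0 ≤ B₀ * (1 - θ * c)⁻¹ := mul_nonneg hB₀ hq1
  have hA₃ : 0 ≤ B₃ * (1 - θ * c)⁻¹ := mul_nonneg hB₃ hq1
  have hCh : 0 ≤ Bh β + θM * (B₀ * (1 - θ * c)⁻¹) * c := add_nonneg hBh (mul_nonneg (mul_nonneg hθM hA₁) hc)
  have hKQ' : 0 ≤ Bq β + θM * (B₃ * (1 - θ * c)⁻¹) * c := add_nonneg hBq (mul_nonneg (mul_nonneg hθM hA₃) hc)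
  have hε' : 0 < β + ε := by linarith
  have hpXdM : HasMaj (cNormR R₀ H₀ 𝔬.blk hG.lenle (-2)) (cNormR R₀ H₀ 𝔭.blkPX hG.lenle (β - 1))
      ((𝔭.ΦX U β ∘ₗ Dd U ν ∘ₗ 𝔬.G0 U) ∘ₗ (𝔬.Tpi U + 𝔬.T2 U)) (fun a b => θM * Real.exp (-(δK * g.dist a b))) :=
    maj_mono_const_z (le_max_left _ _) (hSD.pXd1 ν β hβ0 hβ1)
  have htDdM : HasMaj (bHX (β + ε)) (cNormR R₀ H₀ 𝔬.blk hG.lenle 1) ((𝔬.Tpi U + 𝔬.T2 U) ∘ₗ (𝔬.G0 U ∘ₗ Dds U μ))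
      (fun a b => θM * Real.exp (-(δK * g.dist a b))) :=
    maj_mono_const_z (le_max_right _ _) (hSD.tDd1 μ (β + ε) hε')
  -- rates
  have h1α : (1 - α) * r ≤ r := by rw [sub_mul, one_mul]; exact sub_le_self _ (mul_nonneg hα hr)
  have hρ₂0 : 0 ≤ ρ₄ + 2 * σ := by linarith
  have hρ₂σ : ρ₄ + 2 * σ + σ ≤ (1 - α) * r := by linarith
  have hρ₂α : ρ₄ + 2 * σ ≤ (1 - α) * r := by linarith
  have hρ₂r : ρ₄ + 2 * σ ≤ r := by linarith
  have hρ₂K : ρ₄ + 2 * σ ≤ δK := by linarith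
  have hρ₂0' : ρ₄ + 2 * σ ≤ δ₀ := by linarith
  have hρ₂₃ : ρ₄ + 2 * σ ≤ δ₃ := by linarith
  have hρ₂₃σ : ρ₄ + 2 * σ + σ ≤ δ₃ := by linarith
  set E : (X → ℝ) →ₗ[ℝ] (PX → ℝ) := 𝔭.ΦX U β ∘ₗ Dd U ν with hE
  -- the probe entry Φ^X_β∇_νG₁ : 𝔠^{(0)} → 𝔠_P^{(β−1)} at the rate r
  have hA := probe43d_cNormR hG hrow hθ hθM hB₀ hBh hr hr0 hrK hK2 he0 (hH0.h43d ν β hβ0 hβ1) hpXdM hfix1 hq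
  -- Φ∇_νG₁∇*_μ from `bHX (β+ε)` and Φ∇_νG₁Dv from `bHW (β+ε)` by the right form, into 𝔠_P^{(β)}
  have h45' : HasMaj (bHX (β + ε)) (BlockNorm.ofBlocks (toB6 g R₀ H₀) 𝔭.blkPX) (E ∘ₗ (𝔬.G0 U ∘ₗ Dds U μ))
      (fun (a b : g.Site) => Bi2 ε β * g.len a ^ (-β) * Real.exp (-(δ₀ * g.dist a b))) := hH0.h45m (ν, μ) ε β hε0 hε1 hβ0 hβ1
  have hGop' := input45_of_step hG hrow hθM hBi2 hCh hΛ hρ₂0 hρ₂σ hρ₂K hρ₂0' hST hA h45' htDdM hfixR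
  have hGop : HasMaj (bHX (β + ε)) (cNormR R₀ H₀ 𝔭.blkPX hG.lenle β) (E ∘ₗ (𝔬.G1 U ∘ₗ Dds U μ))
      (fun a b => (Bi2 ε β + (Bh β + θM * (B₀ * (1 - θ * c)⁻¹) * c) * Λ * θM * c) * Real.exp (-((ρ₄ + 2 * σ) * g.dist a b))) :=
    hasMaj_weight_out hG (hGop'.mono fun a b => le_of_eq (by ring))
  have hpd : HasMaj (bHW (β + ε)) (BlockNorm.ofBlocks (toB6 g R₀ H₀) 𝔭.blkPX) (E ∘ₗ (𝔬.G0 U ∘ₗ 𝔬.Dv U))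
      (fun (a b : g.Site) => Bd2 ε β * g.len a ^ (-β) * Real.exp (-(δ₃ * g.dist a b))) := hLIM.pdgDvd ν ε β hε0 hε1 hβ0 hβ1
  have hGD' := input45_of_step hG hrow hθv hBd2 hCh hΛ hρ₂0 hρ₂σ hρ₂K hρ₂₃ hST hA hpd (hLIM.tDv (β + ε) hε') hfixR
  have hGD : HasMaj (bHW (β + ε)) (cNormR R₀ H₀ 𝔭.blkPX hG.lenle β) (E ∘ₗ (𝔬.G1 U ∘ₗ 𝔬.Dv U))
      (fun a b => (Bd2 ε β + (Bh β + θM * (B₀ * (1 - θ * c)⁻¹) * c) * Λ * θv (β + ε) * c) *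
        Real.exp (-((ρ₄ + 2 * σ) * g.dist a b))) :=
    hasMaj_weight_out hG (hGD'.mono fun a b => le_of_eq (by ring))
  -- Φ∇_νG₁Q* : Z_{wZ} → 𝔠_P^{(β−1)} by the left form over the real middle class 𝔠^{(−2)}, then (2.60): Z_{len·wZ} → 𝔠_P^{(β)}
  have hGQr : HasMaj (weightNorm (BlockNorm.ofBlocks (toB6 g R₀ H₀) 𝔬.blkZ) wZ fun y => (hwZ y).le) (cNormR R₀ H₀ 𝔬.blk hG.lenle (-2))
      (𝔬.G1 U ∘ₗ 𝔬.Qstar U) (fun a b => B₃ * (1 - θ * c)⁻¹ * Real.exp (-(r * g.dist a b))) := by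
    have h := hasMaj_toR_tgt hG (hasMaj_right_of_step_weight hG hwZ hrow hθ hB₃ hr hr₃ hrK hK2 hL.gQs2 hfix1 hq)
    simp only [Nat.cast_ofNat] at h
    exact h
  have hpQ' : HasMaj (weightNorm (BlockNorm.ofBlocks (toB6 g R₀ H₀) 𝔬.blkZ) wZ fun y => (hwZ y).le) (cNormR R₀ H₀ 𝔭.blkPX hG.lenle (β - 1))
      (E ∘ₗ 𝔬.G0 U ∘ₗ 𝔬.Qstar U) (fun a b => Bq β * Real.exp (-(δ₃ * g.dist a b))) := hLDM.pQd ν β hβ0 hβ1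
  have hKE : HasMaj (cNormR R₀ H₀ 𝔬.blk hG.lenle (-2)) (cNormR R₀ H₀ 𝔭.blkPX hG.lenle (β - 1))
      (E ∘ₗ 𝔬.G0 U ∘ₗ (𝔬.Tpi U + 𝔬.T2 U)) (fun a b => θM * Real.exp (-(δK * g.dist a b))) := hpXdM
  have hDQ := hasMaj_left_rightR hG hrow hθM hBq hA₃ hr hr₃ le_rfl hrK hKE hpQ' hGQr hfix1
  have hDQT := hasMaj_transfer_weight hG (fun y => (hwZ y).le) hKQ' hST hDQ
  have e2 : β - 1 + 1 = β := by ring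
  rw [e2] at hDQT
  have hGQ : HasMaj (weightNorm (BlockNorm.ofBlocks (toB6 g R₀ H₀) 𝔬.blkZ) (fun y => g.len y * wZ y) fun y => (wZlen_pos hG hwZ y).le)
      (cNormR R₀ H₀ 𝔭.blkPX hG.lenle β) (E ∘ₗ 𝔬.G1 U ∘ₗ 𝔬.Qstar U)
      (fun a b => (Bq β + θM * (B₃ * (1 - θ * c)⁻¹) * c) * Λ * Real.exp (-((ρ₄ + 2 * σ) * g.dist a b))) :=
    hDQT.of_rate_le hG.dnn (mul_nonneg hKQ' hΛ) hρ₂α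
  -- (3.153) in 𝔠_P^{(β)}, then unweighted
  have h := GG_input_of_piecesFZ hG hrow hc hθ hB₀ hB₃ hBr (add_nonneg hBi2 (mul_nonneg (mul_nonneg (mul_nonneg hCh hΛ) hθM) hc))
    (add_nonneg hBd2 (mul_nonneg (mul_nonneg (mul_nonneg hCh hΛ) hθv) hc)) (mul_nonneg hKQ' hΛ) hσ hρ₄ le_rfl hρ₂r hρ₂₃σ hr hr0 hrK hq
    hK1 (hHR.e2d μ) hL hI (hLIM.domX (β + ε) hε') (hLIM.locX (β + ε) hε') (hLIM.rgdd μ (β + ε) hε') hGop hGD hGQ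
  have hu := hasMaj_unweight_out hG h
  refine hu.mono fun a b => le_of_eq ?_
  simp only [constI45]
  ring

/-- ★ **(3.44) FOR 𝔊 ON THE PACKAGED PAIR FAMILY, ε-INDEXED CONSTANTS** (B-twin) — `GG_input44m_of_lettersBZ` for every pair, packaged WITHOUT a |P| factor (`hasMaj_familyOp'`: sup sizes):
the family `familyOp (q ↦ ∇_{U,q.1} ∘ 𝔊 ∘ ∇\*_{U,q.2})` read from `bHX ε` into the sharp blocks of X × (P × P) (block map `blk ∘ Prod.fst`) — the input `h44`
of n06-k's `lines3445_of_hasMaj_fam` for 𝔊's kernel family. [cite: Balaban1985BackgroundPropagators, Thm 3.13 p.426 + (3.44) p.398 + (3.39) p.397] -/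
theorem GG_input44Family_of_lettersBZ (hG : GeoOK g) (𝔭 : HolderProbes g B X Y PX PY) {𝔬 : Ops g B X Y Z W} {U : B.Cfg}
    {Dd Dds : B.Cfg → P → Module.End ℝ (X → ℝ)}
    {bHX : ℝ → BlockNorm (toB6 g R₀ H₀) (X → ℝ)} {bHW : ℝ → BlockNorm (toB6 g R₀ H₀) (W → ℝ)} {bH : BlockNorm (toB6 g R₀ H₀) (W → ℝ)}
    {Bh Bi Bq Bd θH θI θv Br : ℝ → ℝ} {Bi2 Bd2 : ℝ → ℝ → ℝ} {θ θD B₀ B₃ δ₀ δ₃ δK r ρ₄ α Λ σ c ε : ℝ}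
    (hrow : RowSum (toB6 g R₀ H₀) σ c)
    (hc : 0 ≤ c) (hθ : 0 ≤ θ) (hθD : 0 ≤ θD) (hθH : 0 ≤ θI ε) (hθv : 0 ≤ θv ε) (hB₀ : 0 ≤ B₀) (hB₃ : 0 ≤ B₃) (hBi : 0 ≤ Bi ε)
    (hBd : 0 ≤ Bd ε) (hBr : 0 ≤ Br ε) (hΛ : 0 ≤ Λ) (hα : 0 ≤ α) (hσ : 0 ≤ σ) (hε0 : 0 < ε) (hε1 : ε ≤ 1) (hρ₄ : 0 ≤ ρ₄)
    (hρ₄r : ρ₄ + 3 * σ ≤ (1 - α) * r) (hr : 0 ≤ r) (hr0 : r ≤ δ₀) (hr₃ : r ≤ δ₃) (hrK : r + σ ≤ δK) (hq : θ * c < 1)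
    (hST : ScaleTransfer g r α Λ (fun y => g.len y ^ (1 : ℝ)))
    (hK1 : HasMaj (cNorm R₀ H₀ 𝔬.blk hG.lenle 1) (cNorm R₀ H₀ 𝔬.blk hG.lenle 1) (𝔬.G0 U ∘ₗ (𝔬.Tpi U + 𝔬.T2 U))
      (fun a b => θ * Real.exp (-(δK * g.dist a b))))
    (hK2 : HasMaj (cNorm R₀ H₀ 𝔬.blk hG.lenle 2) (cNorm R₀ H₀ 𝔬.blk hG.lenle 2) (𝔬.G0 U ∘ₗ (𝔬.Tpi U + 𝔬.T2 U))
      (fun a b => θ * Real.exp (-(δK * g.dist a b))))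
    (he0 : HasMajorant (g := toB6 g R₀ H₀) 𝔬.blk (𝔬.G0 U) (fun a b => B₀ * g.len a ^ 2 * Real.exp (-(δ₀ * g.dist a b))))
    (hH0 : Thm33G0Dir 𝔬 𝔭 Dd Dds R₀ H₀ bHX B₀ Bh Bi Bi2 δ₀ U) (hHR : Thm33G0DirR 𝔬 Dds R₀ H₀ B₀ δ₀ U)
    (hSD : StepDirB 𝔬 𝔭 Dd Dds R₀ H₀ bHX hG.lenle θD θH θI δK U)
    {wZ : g.Site → ℝ} {hwZ : ∀ y, 0 < wZ y}
    (hL : Letters313Z 𝔬 R₀ H₀ hG wZ hwZ B₃ δ₃ U) (hLDM : Letters313DMZ 𝔬 𝔭 Dd R₀ H₀ hG wZ hwZ B₃ Bq δ₃ bH U)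
    (hLIM : Letters313IMB 𝔬 𝔭 Dd Dds R₀ H₀ hG.lenle bHX bHW Br θv Bd Bd2 δ₃ δK U) (hI : Identities 𝔬 U) :
    HasMaj (bHX ε) (BlockNorm.ofBlocks (toB6 g R₀ H₀) (𝔬.blk ∘ Prod.fst))
      (familyOp (fun q : P × P => Dd U q.1 ∘ₗ (𝔬.GG U ∘ₗ Dds U q.2)))
      (fun (a b : g.Site) => constI44 θ θD (θI ε) (θv ε) B₀ B₃ (Bi ε) (Bd ε) (Br ε) Λ (bHW ε).κ c * Real.exp (-(ρ₄ * g.dist a b))) := by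
  have hq1 : 0 ≤ (1 - θ * c)⁻¹ := inv_nonneg.mpr (by linarith)
  have hK0 : 0 ≤ constI44 θ θD (θI ε) (θv ε) B₀ B₃ (Bi ε) (Bd ε) (Br ε) Λ (bHW ε).κ c := by
    have hκ := (bHW ε).κ_nonneg
    unfold constI44
    positivity
  exact hasMaj_familyOp' (R := R₀) (H := H₀) 𝔬.blk (fun a b => mul_nonneg hK0 (Real.exp_nonneg _))
    fun q => GG_input44m_of_lettersBZ hG 𝔭 hrow hc hθ hθD hθH hθv hB₀ hB₃ hBi hBd hBr hΛ hα hσ hε0 hε1 hρ₄ hρ₄r hr hr0 hr₃ hrK hq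
      hST hK1 hK2 he0 hH0 hHR hSD hL hLDM hLIM hI q.1 q.2

/-- ★ **(3.45) FOR 𝔊 ON THE PACKAGED PAIR FAMILY, PROBES SLICED, β∕ε-INDEXED CONSTANTS, COARSE LETTERS RE-CLASSED** (Z-twin) — `GG_input45m_of_lettersBZ` for every pair, the X-probes sliced over the family
(`sliceProbe_comp_familyOp`) and packaged without a |P| factor (`hasMaj_familyOp'`): `sliceProbe Φ^X_β ∘ familyOp (q ↦ ∇_{U,q.1}𝔊∇\*_{U,q.2})` read from
`bHX (β+ε)` into the probe blocks (block map `blkPX ∘ Prod.fst`) — the input `h45` of n06-k's `lines3445_of_hasMaj_fam` for 𝔊's kernel family.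
[cite: Balaban1985BackgroundPropagators, Thm 3.13 p.426 + (3.45) p.398 + (3.39)–(3.40) p.397] -/
theorem GG_input45Family_of_lettersBZ (hG : GeoOK g) (𝔭 : HolderProbes g B X Y PX PY) {𝔬 : Ops g B X Y Z W} {U : B.Cfg}
    {Dd Dds : B.Cfg → P → Module.End ℝ (X → ℝ)}
    {bHX : ℝ → BlockNorm (toB6 g R₀ H₀) (X → ℝ)} {bHW : ℝ → BlockNorm (toB6 g R₀ H₀) (W → ℝ)} {bH : BlockNorm (toB6 g R₀ H₀) (W → ℝ)}
    {Bh Bi Bq Bd θH θI θv Br : ℝ → ℝ} {Bi2 Bd2 : ℝ → ℝ → ℝ} {θ θD B₀ B₃ β δ₀ δ₃ δK r ρ₄ α Λ σ c ε : ℝ}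
    (hrow : RowSum (toB6 g R₀ H₀) σ c)
    (hc : 0 ≤ c) (hθ : 0 ≤ θ) (hθH : 0 ≤ θH β) (hθv : 0 ≤ θv (β + ε)) (hB₀ : 0 ≤ B₀) (hB₃ : 0 ≤ B₃)
    (hBh : 0 ≤ Bh β) (hBi2 : 0 ≤ Bi2 ε β)
    (hBq : 0 ≤ Bq β) (hBd2 : 0 ≤ Bd2 ε β) (hBr : 0 ≤ Br (β + ε)) (hΛ : 0 ≤ Λ) (hα : 0 ≤ α) (hσ : 0 ≤ σ) (hε0 : 0 < ε) (hε1 : ε ≤ 1)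
    (hβ0 : 0 ≤ β) (hβ1 : β < 1) (hρ₄ : 0 ≤ ρ₄) (hρ₄r : ρ₄ + 3 * σ ≤ (1 - α) * r) (hr : 0 ≤ r) (hr0 : r ≤ δ₀) (hr₃ : r ≤ δ₃)
    (hrK : r + σ ≤ δK) (hq : θ * c < 1) (hST : ScaleTransfer g r α Λ (fun y => g.len y ^ (1 : ℝ)))
    (hK1 : HasMaj (cNorm R₀ H₀ 𝔬.blk hG.lenle 1) (cNorm R₀ H₀ 𝔬.blk hG.lenle 1) (𝔬.G0 U ∘ₗ (𝔬.Tpi U + 𝔬.T2 U))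
      (fun a b => θ * Real.exp (-(δK * g.dist a b))))
    (hK2 : HasMaj (cNorm R₀ H₀ 𝔬.blk hG.lenle 2) (cNorm R₀ H₀ 𝔬.blk hG.lenle 2) (𝔬.G0 U ∘ₗ (𝔬.Tpi U + 𝔬.T2 U))
      (fun a b => θ * Real.exp (-(δK * g.dist a b))))
    (he0 : HasMajorant (g := toB6 g R₀ H₀) 𝔬.blk (𝔬.G0 U) (fun a b => B₀ * g.len a ^ 2 * Real.exp (-(δ₀ * g.dist a b))))
    (hH0 : Thm33G0Dir 𝔬 𝔭 Dd Dds R₀ H₀ bHX B₀ Bh Bi Bi2 δ₀ U) (hHR : Thm33G0DirR 𝔬 Dds R₀ H₀ B₀ δ₀ U)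
    (hSD : StepDirB 𝔬 𝔭 Dd Dds R₀ H₀ bHX hG.lenle θD θH θI δK U)
    {wZ : g.Site → ℝ} {hwZ : ∀ y, 0 < wZ y}
    (hL : Letters313Z 𝔬 R₀ H₀ hG wZ hwZ B₃ δ₃ U) (hLDM : Letters313DMZ 𝔬 𝔭 Dd R₀ H₀ hG wZ hwZ B₃ Bq δ₃ bH U)
    (hLIM : Letters313IMB 𝔬 𝔭 Dd Dds R₀ H₀ hG.lenle bHX bHW Br θv Bd Bd2 δ₃ δK U) (hI : Identities 𝔬 U) :
    HasMaj (bHX (β + ε)) (BlockNorm.ofBlocks (toB6 g R₀ H₀) (𝔭.blkPX ∘ Prod.fst))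
      (sliceProbe (𝔭.ΦX U β) ∘ₗ familyOp (fun q : P × P => Dd U q.1 ∘ₗ (𝔬.GG U ∘ₗ Dds U q.2)))
      (fun (a b : g.Site) => constI45 θ (max (θH β) (θI (β + ε))) (θv (β + ε)) B₀ B₃ (Bh β) (Bi2 ε β) (Bd2 ε β) (Bq β) (Br (β + ε)) Λ
        (bHW (β + ε)).κ c * g.len a ^ (-β) * Real.exp (-(ρ₄ * g.dist a b))) := by
  have hq1 : 0 ≤ (1 - θ * c)⁻¹ := inv_nonneg.mpr (by linarith)
  have hK0 : 0 ≤ constI45 θ (max (θH β) (θI (β + ε))) (θv (β + ε)) B₀ B₃ (Bh β) (Bi2 ε β) (Bd2 ε β) (Bq β) (Br (β + ε)) Λ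
      (bHW (β + ε)).κ c := by
    have hκ := (bHW (β + ε)).κ_nonneg
    unfold constI45
    positivity
  rw [sliceProbe_comp_familyOp]
  refine hasMaj_familyOp' (R := R₀) (H := H₀) 𝔭.blkPX
    (fun a b => mul_nonneg (mul_nonneg hK0 (Real.rpow_nonneg (hG.lenle a) _)) (Real.exp_nonneg _)) fun q => ?_
  have h := GG_input45m_of_lettersBZ hG 𝔭 hrow hc hθ hθH hθv hB₀ hB₃ hBh hBi2 hBq hBd2 hBr hΛ hα hσ hε0 hε1 hβ0 hβ1 hρ₄ hρ₄r hr hr0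
    hr₃ hrK hq hST hK1 hK2 he0 hH0 hHR hSD hL hLDM hLIM hI q.1 q.2
  exact h.congr fun μ => rfl

end OneMember

end

end Literature.MathematicalPhysics.QuantumFieldTheory.Balaban1983to89.B9Thm313WholeDirInputBZ
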